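import Literature.Computability.AlgebraicComplexity.LMR13PLambdaDualDimension
import HarnessLib

/-!
# The LMR boundary form `P_Λ` is irreducible; B. Segre's formula for `Z(P_Λ)` unconditionally — PROOF

Topic `Literature/Computability/AlgebraicComplexity`; theorems only (cell `val-lit`, seat t12 g3;
bears on the statement source Landsberg–Manivel–Ressayre 2013 = DAG row LMR13-A, §3.5). Honest
framing: an elementary irreducibility proof for a 2013 boundary form and its sorry-free
formalization; **`VP ≠ VNP` is NOT proved and nothing here is progress on it.**

**Source.** J. M. Landsberg, L. Manivel, N. Ressayre, *Hypersurfaces with degenerate duals and the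
Geometric Complexity Theory Program*, Comment. Math. Helv. **88** (2013) 469–484, §3.5 (journal
pp. 480–481; arXiv:1004.4802 `paper:arxiv-1004.4802 p0008.txt:L44–56, L99–105`): "Define a
polynomial `P_Λ ∈ S^n(M_n(ℂ))^*` by letting `P_Λ(M) = det_n(A,…,A,S)` … `P_Λ(M) = Σ_{i,j} s_{ij}
Pf_i(A) Pf_j(A)`" and "The hypersurface defined by `P_Λ` has interesting properties. PROPOSITION
3.5.2. The dual variety of the hypersurface `Z(P_Λ)` is …". The text speaks of THE dual variety of
the hypersurface `Z(P_Λ)` and (§2.1) applies B. Segre's formula to irreducible hypersurfaces; the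
irreducibility of `P_Λ` itself is used implicitly and not spelled out in print. This file PROVES it
(in the tree's typing `pLambda n = (1/n)·tr(adj(A)·S)`, `A = (x − xᵀ)/2`, `S = (x + xᵀ)/2`,
`LMR13DualVarieties.lean`) and draws the consequence left conditional in
`LMR13PLambdaDualDimension.lean`.

## What is here (all PROVED; no definition, no named fact)

* `pLambda_irreducible` — **`Irreducible (pLambda n)`** for `n` odd, `n ≥ 3`; `pLambda_prime`.
* `rank_hessianMatrix_pLambda` — B. Segre's formula for `Z(P_Λ)`: `rank H_{P_Λ,y} ≤ 2n` at every
  point `y` of the cone `Z(P_Λ)`, `= 2n` on a non-empty Zariski-open subset of it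
  (`rank_hessianMatrix_pLambda_of_irreducible` of `LMR13PLambdaDualDimension.lean` with its
  irreducibility hypothesis discharged); `segreDimensionFormula_pLambda` — the same in the shape of the
  named fact `SegreDimensionFormula` (`rank = dualVarietyDim (pLambda n) + 2`).
* Tools (namespace `PLambdaIrreducible`): `pderiv_eq_zero_of_aeval_eq` (a polynomial fixed by a
  substitution all of whose components have zero `∂/∂x_v` does not involve `x_v`),
  `degreeOf_eq_zero_iff_pderiv_eq_zero`, `pderiv_eq_zero_of_dvd` (char. 0: a variable absent from a
  non-zero product is absent from its factors), `not_irreducible_of_forall_pderiv_eq_zero`;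
  `pfaffian_allOnes` / `det_allOnes` (the alternating matrix with all `+1` above the diagonal has
  Pfaffian and determinant `1`); `det_submatrix_skewPartMatrix_ne_zero`,
  `pderiv_det_submatrix_skewPartMatrix`, `adjugate_skewPartMatrix_apply_self` (the principal cofactors
  `adj(A)_kk = det(A_{k̂k̂})` of the generic skew part are non-zero and involve no variable `x_{k·}`,
  `x_{·k}`, `x_{jj}`); `aeval_diagScale_pLambda` (**`P_Λ` is affine-linear in the diagonal variables**:
  under `x_kk ↦ T·x_kk` it becomes `T·E + (P_Λ − E)`, `E = (1/n) Σ_k adj(A)_kk x_kk`),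
  `eval_one_aeval_diagScale`, `eval_zero_aeval_diagScale`; `isUnit_of_pLambda_eq_mul` (the core).

## Proof (ours; elementary, no Pfaffian irreducibility and no change of coordinates)

(1) The skew part `A = (x − xᵀ)/2` contains no diagonal variable and `S_kk = x_kk`, so the
diagonal scaling `ρ : x_kk ↦ T·x_kk`, `x_kl ↦ x_kl` (`k ≠ l`) maps `P_Λ = (1/n)·tr(adj(A)·S)` to
`T·E + (P_Λ − E)` with `E = (1/n) Σ_k x_kk·adj(A)_kk` (`aeval_diagScale_pLambda`, via the typer's
`aeval_pLambda`); `E ≠ 0` since `∂E/∂x_00 = adj(A)_00/n ≠ 0`, so `ρ(P_Λ)` has `T`-degree `1`.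
(2) If `P_Λ = F·G` then `deg_T ρ(F) + deg_T ρ(G) = 1` (`ℂ[x][T]` is a domain), so one factor, say
`G`, has `T`-degree `0`: `ρ(G)` is constant, and evaluating at `T = 1` and `T = 0` shows `G` equals
`G` with all `x_kk ↦ 0`, i.e. `∂G/∂x_kk = 0` for every `k` (chain rule, `pderiv_aeval_eq_sum`).
(3) Comparing `T¹`-coefficients in `ρ(F)·G = T·E + (P_Λ − E)` gives `H·G = E`; applying `∂/∂x_kk`
(which kills `G` and every cofactor) gives `(∂H/∂x_kk)·G = adj(A)_kk / n`, so `G ∣ adj(A)_kk =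
det(A_{k̂k̂})` for every `k` (`Matrix.adjugate_fin_succ_eq_det_submatrix`).
(4) `det(A_{k̂k̂}) ≠ 0`: at `x_{ab} = [a<b] − [b<a]` it is the determinant of the all-ones
alternating matrix of even size, `= pf² = 1` (row expansion `pfaffian_fin_add_two`, Cayley
`det_eq_pfaffian_sq`); and `det(A_{k̂k̂})` involves no variable with a coordinate `k` (its entries are
`(x_ab − x_ba)/2`, `a, b ≠ k`, fixed by killing such a variable; `AlgHom.map_det`). Hence an
irreducible factor `q` of `G` (`WfDvdMonoid.exists_irreducible_factor`) has `∂q/∂x_v = 0` for every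
off-diagonal `v = (a, b)` (from `q ∣ det(A_{ââ})`, `degreeOf_mul_eq`) and every diagonal `v` (from
`q ∣ G`), so `q` is a constant (`eq_C_of_forall_pderiv_eq_zero`, characteristic `0`) — impossible.
So `G` is a unit; `P_Λ` is not a unit (`totalDegree_pLambda = n ≥ 3`); hence `P_Λ` is irreducible.

## References

* [LandsbergManivelRessayre2013] J. M. Landsberg, L. Manivel, N. Ressayre, Comment. Math. Helv. 88
  (2013) 469–484, §3.5 (pp. 480–481); arXiv:1004.4802.
* [Landsberg2017] J. M. Landsberg, *Geometry and Complexity Theory*, CUP 2017, Prop. 6.4.5.1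
  (B. Segre's dimension formula).
* [Humphreys1990] J. E. Humphreys, *Reflection Groups and Coxeter Groups*, CUP 1990, § 3.10
  (partial derivatives in characteristic `0`, chain rule).
* [KustinUlrich1992] A. Kustin, B. Ulrich, Mem. AMS 461 (1992), §1 (1.18) (row expansion of the
  Pfaffian); [Cayley1849] A. Cayley, J. reine angew. Math. 38 (1849) 93–96 (`det = pf²`).
-/

noncomputable section

namespace Literature.Computability.AlgebraicComplexity

open MvPolynomial Finset _root_.Matrix Literature.Algebra.Polynomial.JacobianCriterion
  Literature.LinearAlgebra.Matrix

namespace PLambdaIrreducible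

/-! ### Variables not occurring in a polynomial (characteristic `0` bookkeeping) -/

section Vars

variable {V : Type*}

/-- If a substitution `g` fixes `f` and `∂g_w/∂x_v = 0` for every `w`, then `∂f/∂x_v = 0` (chain
rule). Used with `g` = "kill the variable(s) …": a polynomial fixed by killing `x_v` does not
involve `x_v`. [cite: Humphreys1990, § 3.10 (display (23), chain rule)] -/
theorem pderiv_eq_zero_of_aeval_eq [Fintype V] (g : V → MvPolynomial V ℂ) (v : V)
    (hg : ∀ w, pderiv v (g w) = 0) {f : MvPolynomial V ℂ} (hf : aeval g f = f) :
    pderiv v f = 0 := by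
  rw [← hf, pderiv_aeval_eq_sum]
  exact Finset.sum_eq_zero fun w _ => by rw [hg w, mul_zero]

/-- In characteristic `0`, `∂f/∂x_v = 0` iff `x_v` does not occur in `f` (`degreeOf = 0`).
[cite: Humphreys1990, § 3.10] -/
theorem degreeOf_eq_zero_iff_pderiv_eq_zero (v : V) (f : MvPolynomial V ℂ) :
    degreeOf v f = 0 ↔ pderiv v f = 0 := by
  constructor
  · intro h
    apply pderiv_eq_zero_of_notMem_vars
    rw [mem_vars_iff_degreeOf_ne_zero]
    exact fun h' => h' h
  · intro h
    have := notMem_vars_of_pderiv_eq_zero h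
    rw [mem_vars_iff_degreeOf_ne_zero] at this
    push Not at this
    exact this

/-- A variable not occurring in a non-zero product does not occur in the factors.
[cite: Humphreys1990, § 3.10] -/
theorem pderiv_eq_zero_of_dvd {v : V} {q f : MvPolynomial V ℂ} (hf : f ≠ 0) (hqf : q ∣ f)
    (hv : pderiv v f = 0) : pderiv v q = 0 := by
  obtain ⟨r, rfl⟩ := hqf
  have hq : q ≠ 0 := left_ne_zero_of_mul hf
  have hr : r ≠ 0 := right_ne_zero_of_mul hf
  rw [← degreeOf_eq_zero_iff_pderiv_eq_zero] at hv ⊢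
  rw [degreeOf_mul_eq hq hr] at hv
  omega

/-- A polynomial all of whose partial derivatives vanish is a unit or zero; an irreducible
polynomial therefore involves some variable. [cite: Humphreys1990, § 3.10] -/
theorem not_irreducible_of_forall_pderiv_eq_zero {q : MvPolynomial V ℂ} (h : ∀ v, pderiv v q = 0) :
    ¬ Irreducible q := by
  intro hq
  have hC := eq_C_of_forall_pderiv_eq_zero h
  by_cases hc : coeff 0 q = 0
  · exact hq.ne_zero (by rw [hC, hc, C_0])
  · exact hq.not_isUnit (by rw [hC]; exact (isUnit_iff_ne_zero.mpr hc).map C)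

end Vars

/-! ### The all-ones alternating matrix: `pf = 1`, `det = 1` -/

section AllOnes

/-- `Σ_{j ≤ 2h} (−1)^j = 1`. [folklore] -/
private theorem sum_neg_one_pow_fin_odd (h : ℕ) :
    ∑ j : Fin (2 * h + 1), ((-1 : ℂ) ^ (j : ℕ)) = 1 := by
  induction h with
  | zero => simp
  | succ h ih =>
    have e : 2 * (h + 1) + 1 = (2 * h + 1) + 2 := by ring
    rw [Fin.sum_univ_eq_sum_range (f := fun j => ((-1 : ℂ) ^ j)), e, Finset.sum_range_succ,
      Finset.sum_range_succ, ← Fin.sum_univ_eq_sum_range (f := fun j => ((-1 : ℂ) ^ j)), ih]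
    ring

/-- The Pfaffian of the `2h × 2h` alternating matrix with all entries `+1` above the diagonal is
`1` (row expansion: `pf(T_{2h+2}) = (Σ_{j ≤ 2h} (−1)^j) · pf(T_{2h}) = pf(T_{2h})`).
[cite: KustinUlrich1992, §1 (1.18)] -/
theorem pfaffian_allOnes (h : ℕ) :
    pfaffian (Matrix.of fun a b : Fin (2 * h) =>
      if a < b then (1 : ℂ) else if b < a then -1 else 0) = 1 := by
  induction h with
  | zero => rfl
  | succ h ih =>
    have e : 2 * (h + 1) = 2 * h + 2 := by ring
    rw [e]
    rw [pfaffian_fin_add_two]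
    have hminor : ∀ j : Fin (2 * h + 1),
        pfMinor (Matrix.of fun a b : Fin (2 * h + 2) =>
          if a < b then (1 : ℂ) else if b < a then -1 else 0) j =
        Matrix.of fun a b : Fin (2 * h) => if a < b then (1 : ℂ) else if b < a then -1 else 0 := by
      intro j
      ext a b
      simp only [pfMinor_apply, Matrix.of_apply, Fin.succ_lt_succ_iff,
        (Fin.strictMono_succAbove j).lt_iff_lt]
    have hentry : ∀ j : Fin (2 * h + 1),
        (Matrix.of fun a b : Fin (2 * h + 2) =>
          if a < b then (1 : ℂ) else if b < a then -1 else 0) 0 j.succ = 1 := fun j => by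
      simp [Matrix.of_apply, Fin.succ_pos]
    simp_rw [hminor, hentry, ih, mul_one]
    exact sum_neg_one_pow_fin_odd h

/-- Hence its determinant is `1` (Cayley: `det = pf²`). [cite: Cayley1849, pp. 93–96] -/
theorem det_allOnes (h : ℕ) :
    (Matrix.of fun a b : Fin (2 * h) =>
      if a < b then (1 : ℂ) else if b < a then -1 else 0).det = 1 := by
  rw [det_eq_pfaffian_sq _ ?_ ?_, pfaffian_allOnes, one_pow]
  · ext a b
    simp only [Matrix.transpose_apply, Matrix.neg_apply, Matrix.of_apply]
    rcases lt_trichotomy a b with hab | rfl | hab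
    · simp [hab, lt_asymm hab]
    · simp
    · simp [hab, lt_asymm hab]
  · intro a
    simp

end AllOnes

/-! ### The principal cofactors of the skew part: non-zero, and free of the variables of their index -/

section Cofactors

/-- At the point `x_{ab} = [a < b] − [b < a]` the skew part `(x − xᵀ)/2` restricted to the indices
`≠ k` is the all-ones alternating matrix, so the principal cofactor
`det((skew part)_{k̂k̂})` of the generic skew part is a NON-ZERO polynomial (`n = 2h + 1`).
[cite: LandsbergManivelRessayre2013, §3.5 (p. 480)] -/
theorem det_submatrix_skewPartMatrix_ne_zero (h : ℕ) (k : Fin (2 * h + 1)) :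
    ((skewPartMatrix (2 * h + 1)).submatrix k.succAbove k.succAbove).det ≠ 0 := by
  intro h0
  set y₁ : Fin (2 * h + 1) × Fin (2 * h + 1) → ℂ :=
    fun v => if v.1 < v.2 then 1 else if v.2 < v.1 then -1 else 0 with hy₁
  have h1 := RingHom.map_det (eval y₁) ((skewPartMatrix (2 * h + 1)).submatrix k.succAbove k.succAbove)
  have hT : (eval y₁).mapMatrix ((skewPartMatrix (2 * h + 1)).submatrix k.succAbove k.succAbove) =
      Matrix.of fun a b : Fin (2 * h) => if a < b then (1 : ℂ) else if b < a then -1 else 0 := by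
    ext a b
    simp only [RingHom.mapMatrix_apply, Matrix.map_apply, Matrix.submatrix_apply, skewPartMatrix,
      Matrix.of_apply, map_mul, eval_C, map_sub, eval_X, hy₁,
      (Fin.strictMono_succAbove k).lt_iff_lt]
    rcases lt_trichotomy a b with hab | rfl | hab
    · rw [if_pos hab, if_neg (lt_asymm hab), if_pos hab]; norm_num
    · simp
    · rw [if_neg (lt_asymm hab), if_pos hab, if_neg (lt_asymm hab), if_pos hab]; norm_num
  rw [h0, map_zero, hT, det_allOnes] at h1
  exact zero_ne_one h1

variable {m : ℕ}

/-- Killing a variable touching the index `k` (first or second coordinate `k`), or a diagonal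
variable, fixes every entry of the skew part restricted to the indices `≠ k`. [folklore] -/
private theorem aeval_kill_submatrix_skewPartMatrix (k : Fin (m + 1)) (v : Fin (m + 1) × Fin (m + 1))
    (hv : v.1 = k ∨ v.2 = k ∨ v.1 = v.2) :
    (aeval fun w : Fin (m + 1) × Fin (m + 1) => if w = v then (0 : MvPolynomial _ ℂ) else X w).mapMatrix
        ((skewPartMatrix (m + 1)).submatrix k.succAbove k.succAbove) =
      (skewPartMatrix (m + 1)).submatrix k.succAbove k.succAbove := by
  refine Matrix.ext fun i j => ?_
  simp only [AlgHom.mapMatrix_apply, Matrix.map_apply, Matrix.submatrix_apply, skewPartMatrix,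
    Matrix.of_apply, map_mul, MvPolynomial.algHom_C, MvPolynomial.algebraMap_eq, map_sub, aeval_X]
  by_cases h1 : ((k.succAbove i, k.succAbove j) : Fin (m + 1) × Fin (m + 1)) = v
  · -- then `v` is diagonal and `i = j`
    have hij : i = j := by
      rcases hv with hv | hv | hv
      · exact absurd (by have h' := hv; rw [← h1] at h'; exact h') (Fin.succAbove_ne k i)
      · exact absurd (by have h' := hv; rw [← h1] at h'; exact h') (Fin.succAbove_ne k j)
      · exact Fin.succAbove_right_injective (by have h' := hv; rw [← h1] at h'; exact h')
    subst hij
    simp only [if_pos h1, sub_self]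
  · by_cases h2 : ((k.succAbove j, k.succAbove i) : Fin (m + 1) × Fin (m + 1)) = v
    · have hij : i = j := by
        rcases hv with hv | hv | hv
        · exact absurd (by have h' := hv; rw [← h2] at h'; exact h') (Fin.succAbove_ne k j)
        · exact absurd (by have h' := hv; rw [← h2] at h'; exact h') (Fin.succAbove_ne k i)
        · exact (Fin.succAbove_right_injective (by have h' := hv; rw [← h2] at h'; exact h')).symm
      subst hij
      exact absurd h2 h1
    · rw [if_neg h1, if_neg h2]

/-- **The principal cofactor `det((skew part)_{k̂k̂})` involves no variable `x_{kb}`, `x_{ak}` and no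
diagonal variable**: its partial derivative in each such variable vanishes.
[cite: LandsbergManivelRessayre2013, §3.5 (p. 480)] -/
theorem pderiv_det_submatrix_skewPartMatrix (k : Fin (m + 1)) (v : Fin (m + 1) × Fin (m + 1))
    (hv : v.1 = k ∨ v.2 = k ∨ v.1 = v.2) :
    pderiv v ((skewPartMatrix (m + 1)).submatrix k.succAbove k.succAbove).det = 0 := by
  refine pderiv_eq_zero_of_aeval_eq
    (fun w : Fin (m + 1) × Fin (m + 1) => if w = v then (0 : MvPolynomial _ ℂ) else X w) v
    (fun w => ?_) ?_
  · by_cases hw : w = v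
    · rw [if_pos hw, map_zero]
    · rw [if_neg hw, pderiv_X, Pi.single_eq_of_ne hw]
  · rw [AlgHom.map_det, aeval_kill_submatrix_skewPartMatrix k v hv]

/-- The diagonal adjugate entry is the principal cofactor (`adj(A)_kk = det A_{k̂k̂}`).
[cite: HornJohnson2013, §0.8.2 (cofactors and the adjugate)] -/
theorem adjugate_skewPartMatrix_apply_self (k : Fin (m + 1)) :
    (skewPartMatrix (m + 1)).adjugate k k =
      ((skewPartMatrix (m + 1)).submatrix k.succAbove k.succAbove).det := by
  rw [Matrix.adjugate_fin_succ_eq_det_submatrix, ← two_mul, pow_mul, neg_one_sq, one_pow, one_mul]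

end Cofactors

/-! ### `P_Λ` is affine-linear in the diagonal variables: the substitution `x_kk ↦ x_kk · T` -/

section Rho

variable (n : ℕ)

/-- **`P_Λ(x with x_kk ↦ T·x_kk) = T · E + (P_Λ − E)`**, `E = (1/n) Σ_k x_kk · adj((x − xᵀ)/2)_{kk}`:
the skew part contains no diagonal variable and the symmetric part has `x_kk` only in its `(k,k)`
entry, so `tr(adj(A) · S)` is affine-linear in the diagonal variables with top part `Σ_k adj(A)_kk x_kk`.
[cite: LandsbergManivelRessayre2013, §3.5 (p. 480)] -/
theorem aeval_diagScale_pLambda :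
    aeval (fun p : Fin n × Fin n =>
        if p.1 = p.2 then Polynomial.C (X p) * Polynomial.X else Polynomial.C (X p)) (pLambda n) =
      Polynomial.C (C (1 / (n : ℂ)) * ∑ k, (skewPartMatrix n).adjugate k k * X (k, k)) * Polynomial.X +
        Polynomial.C (pLambda n - C (1 / (n : ℂ)) * ∑ k, (skewPartMatrix n).adjugate k k * X (k, k)) := by
  set M : Matrix (Fin n) (Fin n) (Polynomial (MvPolynomial (Fin n × Fin n) ℂ)) :=
    Matrix.of fun k l => if k = l then Polynomial.C (X (k, l)) * Polynomial.X
      else Polynomial.C (X (k, l)) with hM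
  have hfun : (fun p : Fin n × Fin n =>
      if p.1 = p.2 then Polynomial.C (X p) * Polynomial.X else Polynomial.C (X p)) =
      fun p => M p.1 p.2 := by
    funext p
    simp [hM]
  rw [hfun, aeval_pLambda M]
  -- the skew and symmetric parts of `M`
  have hA : (1 / 2 : ℂ) • (M - Mᵀ) =
      (skewPartMatrix n).map (Polynomial.C : MvPolynomial (Fin n × Fin n) ℂ →+* _) := by
    refine Matrix.ext fun k l => ?_
    by_cases hkl : k = l
    · subst hkl
      simp [hM, skewPartMatrix]
    · have hlk : ¬ l = k := fun h => hkl h.symm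
      simp [hM, skewPartMatrix, hkl, hlk, Algebra.smul_def, mul_sub]
  have hS : (1 / 2 : ℂ) • (M + Mᵀ) =
      (symPartMatrix n).map (Polynomial.C : MvPolynomial (Fin n × Fin n) ℂ →+* _) +
        ((Polynomial.X : Polynomial (MvPolynomial (Fin n × Fin n) ℂ)) - 1) •
          Matrix.diagonal fun k => Polynomial.C (X (k, k)) := by
    have h2 : Polynomial.C (C (2⁻¹ : ℂ)) * (2 : Polynomial (MvPolynomial (Fin n × Fin n) ℂ)) = 1 := by
      rw [show (2 : Polynomial (MvPolynomial (Fin n × Fin n) ℂ)) = Polynomial.C (C (2 : ℂ)) by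
        rw [map_ofNat, map_ofNat], ← map_mul, ← map_mul]
      norm_num
    refine Matrix.ext fun k l => ?_
    by_cases hkl : k = l
    · subst hkl
      simp [hM, symPartMatrix, Algebra.smul_def]
      linear_combination (Polynomial.C (X (k, k)) * Polynomial.X - Polynomial.C (X (k, k))) * h2
    · have hlk : ¬ l = k := fun h => hkl h.symm
      simp [hM, symPartMatrix, hkl, hlk, Algebra.smul_def, mul_add]
  rw [hA, hS, Matrix.mul_add, Matrix.trace_add, Matrix.mul_smul, Matrix.trace_smul,
    ← RingHom.mapMatrix_apply, ← RingHom.map_adjugate, RingHom.mapMatrix_apply, ← Matrix.map_mul,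
    ← AddMonoidHom.map_trace (Polynomial.C : MvPolynomial (Fin n × Fin n) ℂ →+* _)]
  have htr : ((skewPartMatrix n).adjugate.map (Polynomial.C : MvPolynomial (Fin n × Fin n) ℂ →+* _) *
      Matrix.diagonal fun k => Polynomial.C (X (k, k))).trace =
      Polynomial.C (∑ k, (skewPartMatrix n).adjugate k k * X (k, k)) := by
    rw [Matrix.trace, map_sum]
    refine Finset.sum_congr rfl fun k _ => ?_
    rw [Matrix.diag_apply, Matrix.mul_diagonal, Matrix.map_apply, ← map_mul]
  rw [htr, pLambda, Algebra.smul_def, Polynomial.algebraMap_apply, MvPolynomial.algebraMap_eq,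
    smul_eq_mul]
  simp only [map_sub, map_mul]
  ring

/-- Setting `T = 1` undoes the diagonal scaling `x_kk ↦ T·x_kk`.
[cite: LandsbergManivelRessayre2013, §3.5 (p. 480)] -/
theorem eval_one_aeval_diagScale (f : MvPolynomial (Fin n × Fin n) ℂ) :
    Polynomial.eval 1 (aeval (fun p : Fin n × Fin n =>
        if p.1 = p.2 then Polynomial.C (X p) * Polynomial.X else Polynomial.C (X p)) f) = f := by
  have h : (Polynomial.evalRingHom (1 : MvPolynomial (Fin n × Fin n) ℂ)).comp
      (aeval (R := ℂ) (fun p : Fin n × Fin n =>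
        if p.1 = p.2 then Polynomial.C (X p) * Polynomial.X else Polynomial.C (X p))).toRingHom =
      RingHom.id (MvPolynomial (Fin n × Fin n) ℂ) := by
    refine MvPolynomial.ringHom_ext (fun c => ?_) (fun v => ?_)
    · simp
    · simp only [RingHom.coe_comp, AlgHom.toRingHom_eq_coe, RingHom.coe_coe, Function.comp_apply,
        aeval_X, Polynomial.coe_evalRingHom, RingHom.id_apply]
      split_ifs <;> simp
  exact congrFun (congrArg DFunLike.coe h) f

/-- Setting `T = 0` in the diagonal scaling kills the diagonal variables.
[cite: LandsbergManivelRessayre2013, §3.5 (p. 480)] -/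
theorem eval_zero_aeval_diagScale (f : MvPolynomial (Fin n × Fin n) ℂ) :
    Polynomial.eval 0 (aeval (fun p : Fin n × Fin n =>
        if p.1 = p.2 then Polynomial.C (X p) * Polynomial.X else Polynomial.C (X p)) f) =
      aeval (fun p : Fin n × Fin n => if p.1 = p.2 then (0 : MvPolynomial _ ℂ) else X p) f := by
  have h : (Polynomial.evalRingHom (0 : MvPolynomial (Fin n × Fin n) ℂ)).comp
      (aeval (R := ℂ) (fun p : Fin n × Fin n =>
        if p.1 = p.2 then Polynomial.C (X p) * Polynomial.X else Polynomial.C (X p))).toRingHom =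
      (aeval (R := ℂ) (fun p : Fin n × Fin n =>
        if p.1 = p.2 then (0 : MvPolynomial (Fin n × Fin n) ℂ) else X p)).toRingHom := by
    refine MvPolynomial.ringHom_ext (fun c => ?_) (fun v => ?_)
    · simp
    · simp only [RingHom.coe_comp, AlgHom.toRingHom_eq_coe, RingHom.coe_coe, Function.comp_apply,
        aeval_X, Polynomial.coe_evalRingHom]
      split_ifs <;> simp
  exact congrFun (congrArg DFunLike.coe h) f

end Rho

/-! ### `P_Λ` is irreducible -/

section Main

variable {m : ℕ}

/-- `∂/∂x_kk` of the top part `E = (1/n) Σ_j adj(A)_jj x_jj` is `(1/n) adj(A)_kk` (the cofactors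
are diagonal-free). [cite: LandsbergManivelRessayre2013, §3.5 (p. 480)] -/
private theorem pderiv_diag_top (c : ℂ) (k : Fin (m + 1)) :
    pderiv (k, k) (C c * ∑ j, (skewPartMatrix (m + 1)).adjugate j j * X (j, j)) =
      C c * (skewPartMatrix (m + 1)).adjugate k k := by
  rw [pderiv_C_mul, map_sum]
  congr 1
  have hterm : ∀ j : Fin (m + 1), pderiv (k, k) ((skewPartMatrix (m + 1)).adjugate j j * X (j, j)) =
      if j = k then (skewPartMatrix (m + 1)).adjugate k k else 0 := by
    intro j
    rw [pderiv_mul, adjugate_skewPartMatrix_apply_self,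
      pderiv_det_submatrix_skewPartMatrix j (k, k) (Or.inr (Or.inr rfl)), zero_mul, zero_add, pderiv_X]
    by_cases hjk : j = k
    · subst hjk
      rw [Pi.single_eq_same, mul_one, if_pos rfl, adjugate_skewPartMatrix_apply_self]
    · have hne : ((j, j) : Fin (m + 1) × Fin (m + 1)) ≠ (k, k) := fun h => hjk (Prod.mk.inj h).1
      rw [Pi.single_eq_of_ne hne, mul_zero, if_neg hjk]
  simp_rw [hterm]
  rw [Finset.sum_ite_eq' Finset.univ k, if_pos (Finset.mem_univ k)]

/-- **The core of the irreducibility proof**: if `P_Λ = F · G` (`n = 2h + 1 ≥ 3`) and `G` has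
degree `0` in `T` after the diagonal scaling `x_kk ↦ T·x_kk`, then `G` is a unit. Indeed `G` is
then free of the diagonal variables, comparing `T¹`-coefficients gives `G ∣ E`, differentiating in
`x_kk` gives `G ∣ adj(A)_kk` for every `k`; an irreducible factor `q` of `G` would divide all these
non-zero principal cofactors, each free of the variables touching its index, so `q` would involve no
variable at all. [cite: LandsbergManivelRessayre2013, §3.5 (p. 480)] -/
theorem isUnit_of_pLambda_eq_mul (h : ℕ) (hh : 1 ≤ h) {F G : MvPolynomial (Fin (2 * h + 1) × Fin (2 * h + 1)) ℂ}
    (hFG : pLambda (2 * h + 1) = F * G)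
    (hdeg : (aeval (fun p : Fin (2 * h + 1) × Fin (2 * h + 1) =>
        if p.1 = p.2 then Polynomial.C (X p : MvPolynomial (Fin (2 * h + 1) × Fin (2 * h + 1)) ℂ) *
          Polynomial.X else Polynomial.C (X p)) G).natDegree = 0) :
    IsUnit G := by
  classical
  have hodd : Odd (2 * h + 1) := ⟨h, rfl⟩
  set ρ : MvPolynomial (Fin (2 * h + 1) × Fin (2 * h + 1)) ℂ →ₐ[ℂ]
      Polynomial (MvPolynomial (Fin (2 * h + 1) × Fin (2 * h + 1)) ℂ) :=
    aeval (fun p : Fin (2 * h + 1) × Fin (2 * h + 1) =>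
      if p.1 = p.2 then Polynomial.C (X p) * Polynomial.X else Polynomial.C (X p)) with hρ
  set E : MvPolynomial (Fin (2 * h + 1) × Fin (2 * h + 1)) ℂ :=
    C (1 / ((2 * h + 1 : ℕ) : ℂ)) * ∑ k, (skewPartMatrix (2 * h + 1)).adjugate k k * X (k, k) with hE
  have hP0 : pLambda (2 * h + 1) ≠ 0 := pLambda_ne_zero hodd
  have hG0 : G ≠ 0 := fun h0 => hP0 (by rw [hFG, h0, mul_zero])
  have hF0 : F ≠ 0 := fun h0 => hP0 (by rw [hFG, h0, zero_mul])
  -- `G` is diagonal-free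
  have hρG : ρ G = Polynomial.C ((ρ G).coeff 0) := Polynomial.eq_C_of_natDegree_eq_zero hdeg
  have hc : (ρ G).coeff 0 = G := by
    have h1 := eval_one_aeval_diagScale (2 * h + 1) G
    rw [← hρ] at h1
    conv_rhs => rw [← h1]
    rw [hρG, Polynomial.eval_C, Polynomial.coeff_C_zero]
  have hGfix : aeval (fun p : Fin (2 * h + 1) × Fin (2 * h + 1) =>
      if p.1 = p.2 then (0 : MvPolynomial _ ℂ) else X p) G = G := by
    rw [← eval_zero_aeval_diagScale, ← hρ, hρG, Polynomial.eval_C, hc]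
  have hGdiag : ∀ k : Fin (2 * h + 1), pderiv (k, k) G = 0 := fun k =>
    pderiv_eq_zero_of_aeval_eq _ (k, k) (fun w => by
      by_cases hw : w.1 = w.2
      · rw [if_pos hw, map_zero]
      · rw [if_neg hw, pderiv_X, Pi.single_eq_of_ne]
        rintro rfl
        exact hw rfl) hGfix
  -- `G ∣ E`, the `T¹`-coefficient
  have hρP : ρ (pLambda (2 * h + 1)) = Polynomial.C E * Polynomial.X +
      Polynomial.C (pLambda (2 * h + 1) - E) := aeval_diagScale_pLambda (2 * h + 1)
  have hcoef : (ρ F).coeff 1 * G = E := by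
    have h1 := congrArg (fun p => Polynomial.coeff p 1) hρP
    rw [hFG, map_mul, hρG, hc] at h1
    simpa only [Polynomial.coeff_mul_C, Polynomial.coeff_add, Polynomial.coeff_C_mul,
      Polynomial.coeff_X_one, mul_one, Polynomial.coeff_C, if_neg one_ne_zero, add_zero] using h1
  -- `G ∣ adj(A)_kk` for every `k`
  have hGdvd : ∀ k : Fin (2 * h + 1),
      G ∣ ((skewPartMatrix (2 * h + 1)).submatrix k.succAbove k.succAbove).det := by
    intro k
    have h1 := congrArg (pderiv (k, k)) hcoef
    rw [hE, pderiv_diag_top, pderiv_mul, hGdiag k, mul_zero, add_zero,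
      adjugate_skewPartMatrix_apply_self] at h1
    have hu : IsUnit (C (1 / ((2 * h + 1 : ℕ) : ℂ)) : MvPolynomial (Fin (2 * h + 1) × Fin (2 * h + 1)) ℂ) :=
      (isUnit_iff_ne_zero.mpr (one_div_ne_zero (Nat.cast_ne_zero.mpr (by omega)))).map C
    exact (hu.dvd_mul_left).mp ⟨_, h1.symm.trans (mul_comm _ _)⟩
  -- an irreducible factor of `G` would involve no variable
  by_contra hGu
  obtain ⟨q, hq, hqG⟩ := WfDvdMonoid.exists_irreducible_factor hGu hG0
  refine not_irreducible_of_forall_pderiv_eq_zero (fun v => ?_) hq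
  by_cases hv : v.1 = v.2
  · have h1 := hGdiag v.1
    have hvv : ((v.1, v.1) : Fin (2 * h + 1) × Fin (2 * h + 1)) = v := Prod.ext rfl hv
    rw [hvv] at h1
    exact pderiv_eq_zero_of_dvd hG0 hqG h1
  · exact pderiv_eq_zero_of_dvd (det_submatrix_skewPartMatrix_ne_zero h v.1)
      (hqG.trans (hGdvd v.1)) (pderiv_det_submatrix_skewPartMatrix v.1 v (Or.inl rfl))

end Main

end PLambdaIrreducible

open PLambdaIrreducible in
/-- **The boundary form `P_Λ` is irreducible** (`n` odd, `n ≥ 3`). LMR 2013 §3.5 treats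
"the hypersurface `Z(P_Λ)`" and "the dual variety of the hypersurface `Z(P_Λ)`" (Prop. 3.5.2,
p. 481) as those of an irreducible form; this is the algebraic fact behind it, needed to apply
B. Segre's formula (`SegreDimensionFormula`, typed for irreducible forms) to `P_Λ`. PROOF (ours):
`P_Λ = (1/n) tr(adj(A) S)` is affine-linear in the diagonal variables `x_kk` (`A = (x − xᵀ)/2` has
none, `S_kk = x_kk`) with top part `E = (1/n) Σ_k adj(A)_kk x_kk ≠ 0`; scaling the diagonal
variables by `T` (`aeval_diagScale_pLambda`) a factorisation `P_Λ = F·G` has one factor of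
`T`-degree `0`, i.e. free of the diagonal variables, and that factor is a unit
(`isUnit_of_pLambda_eq_mul`: it divides every principal cofactor `adj(A)_kk = det(A_{k̂k̂})`, a
non-zero polynomial free of the variables `x_{k·}`, `x_{·k}`, so an irreducible factor of it would
be constant). `P_Λ` is not a unit since `deg P_Λ = n ≥ 3` (`totalDegree_pLambda`).
[cite: LandsbergManivelRessayre2013, §3.5 and Proposition 3.5.2 (pp. 480–481)] -/
theorem pLambda_irreducible {n : ℕ} (hn : Odd n) (h3 : 3 ≤ n) : Irreducible (pLambda n) := by
  classical
  obtain ⟨h, rfl⟩ : ∃ h, n = 2 * h + 1 := by obtain ⟨k, hk⟩ := hn; exact ⟨k, by omega⟩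
  have hh : 1 ≤ h := by omega
  have hP0 : pLambda (2 * h + 1) ≠ 0 := pLambda_ne_zero hn
  refine irreducible_iff.2 ⟨fun hu => ?_, fun F G hFG => ?_⟩
  · -- not a unit: degree `n ≥ 3`
    obtain ⟨Q, hQ⟩ := hu.exists_right_inv
    have hQ0 : Q ≠ 0 := fun h0 => by rw [h0, mul_zero] at hQ; exact zero_ne_one hQ
    have hdeg := totalDegree_mul_of_isDomain hP0 hQ0
    rw [hQ, totalDegree_one, totalDegree_pLambda hn] at hdeg
    omega
  · -- a factorisation: one factor has `T`-degree `0` after the diagonal scaling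
    set ρ : MvPolynomial (Fin (2 * h + 1) × Fin (2 * h + 1)) ℂ →ₐ[ℂ]
        Polynomial (MvPolynomial (Fin (2 * h + 1) × Fin (2 * h + 1)) ℂ) :=
      aeval (fun p : Fin (2 * h + 1) × Fin (2 * h + 1) =>
        if p.1 = p.2 then Polynomial.C (X p) * Polynomial.X else Polynomial.C (X p)) with hρ
    have hE0 : C (1 / ((2 * h + 1 : ℕ) : ℂ)) *
        ∑ k, (skewPartMatrix (2 * h + 1)).adjugate k k * X (k, k) ≠ 0 := by
      intro h0
      have h1 := congrArg (pderiv ((0 : Fin (2 * h + 1)), (0 : Fin (2 * h + 1)))) h0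
      rw [pderiv_diag_top, map_zero, adjugate_skewPartMatrix_apply_self] at h1
      exact (mul_ne_zero (C_ne_zero.mpr (one_div_ne_zero (Nat.cast_ne_zero.mpr (by omega))))
        (det_submatrix_skewPartMatrix_ne_zero h 0)) h1
    have hdegP : (ρ (pLambda (2 * h + 1))).natDegree = 1 := by
      have hρP : ρ (pLambda (2 * h + 1)) = _ := aeval_diagScale_pLambda (2 * h + 1)
      rw [hρP, Polynomial.natDegree_add_C, Polynomial.natDegree_C_mul_X _ hE0]
    have hF0 : F ≠ 0 := fun h0 => hP0 (by rw [hFG, h0, zero_mul])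
    have hG0 : G ≠ 0 := fun h0 => hP0 (by rw [hFG, h0, mul_zero])
    have hρinj : ∀ f, ρ f = 0 → f = 0 := fun f hf => by
      have := eval_one_aeval_diagScale (2 * h + 1) f
      rw [← hρ, hf, Polynomial.eval_zero] at this
      exact this.symm
    have hρF0 : ρ F ≠ 0 := fun h0 => hF0 (hρinj F h0)
    have hρG0 : ρ G ≠ 0 := fun h0 => hG0 (hρinj G h0)
    have hsum : (ρ F).natDegree + (ρ G).natDegree = 1 := by
      rw [← Polynomial.natDegree_mul hρF0 hρG0, ← map_mul, ← hFG, hdegP]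
    rcases Nat.eq_zero_or_pos (ρ G).natDegree with hG | hG
    · exact Or.inr (isUnit_of_pLambda_eq_mul h hh hFG hG)
    · have hF : (ρ F).natDegree = 0 := by omega
      exact Or.inl (isUnit_of_pLambda_eq_mul h hh (hFG.trans (mul_comm F G)) hF)

/-- `P_Λ` is a prime element of `ℂ[x_ij]` (`n` odd, `n ≥ 3`).
[cite: LandsbergManivelRessayre2013, §3.5 (p. 480)] -/
theorem pLambda_prime {n : ℕ} (hn : Odd n) (h3 : 3 ≤ n) : Prime (pLambda n) :=
  (pLambda_irreducible hn h3).prime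

/-! ### B. Segre's formula for `P_Λ`, unconditionally -/

/-- **Generic Hessian rank of `P_Λ` on `Z(P_Λ)` is `2n`** (`n` odd, `n ≥ 3`): at every point `y` of
the cone `Z(P_Λ)`, `rank H_{P_Λ,y} ≤ 2n`, with equality on a non-empty Zariski-open subset
`{g ≠ 0} ∩ Z(P_Λ)` — B. Segre's formula `dim Z(P)^* = rank H_{P,w} − 2` at a general point
(`segreDimension_core`) for the irreducible form `P_Λ` (`pLambda_irreducible`) combined with
`dim Z(P_Λ)^* = 2n − 2` (`dualVarietyDim_pLambda`). This is `rank_hessianMatrix_pLambda_of_irreducible`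
with its irreducibility hypothesis discharged. (Compare `det_n`: rank `2n` at corank-one matrices,
`rank_hessianMatrix_detPoly_le`; and `det_hessianMatrix_pLambda_eq_zero` — the full `n² × n²` Hessian of
`P_Λ` is singular everywhere.) [cite: LandsbergManivelRessayre2013, §2.1 and Proposition 3.5.2 (pp. 471, 481); Landsberg2017, Prop. 6.4.5.1] -/
theorem rank_hessianMatrix_pLambda {n : ℕ} (hn : Odd n) (h3 : 3 ≤ n) :
    (∀ y : Fin n × Fin n → ℂ, eval y (pLambda n) = 0 → (hessianMatrix (pLambda n) y).rank ≤ 2 * n) ∧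
    ∃ g : MvPolynomial (Fin n × Fin n) ℂ,
      (∃ y, eval y (pLambda n) = 0 ∧ eval y g ≠ 0) ∧
      ∀ y, eval y (pLambda n) = 0 → eval y g ≠ 0 → (hessianMatrix (pLambda n) y).rank = 2 * n :=
  rank_hessianMatrix_pLambda_of_irreducible hn h3 (pLambda_irreducible hn h3)

/-- B. Segre's formula for `P_Λ` in the shape of the named fact `SegreDimensionFormula`, with the
dimension made explicit: there is a polynomial `g`, not identically zero on `Z(P_Λ)`, off which the
Hessian of `P_Λ` has rank exactly `dualVarietyDim (pLambda n) + 2 = 2n` on the cone.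
[cite: LandsbergManivelRessayre2013, §2.1 (p. 471); Landsberg2017, Prop. 6.4.5.1] -/
theorem segreDimensionFormula_pLambda {n : ℕ} (hn : Odd n) (h3 : 3 ≤ n) :
    ∃ g : MvPolynomial (Fin n × Fin n) ℂ,
      (∃ y, eval y (pLambda n) = 0 ∧ eval y g ≠ 0) ∧
      ∀ y, eval y (pLambda n) = 0 → eval y g ≠ 0 →
        (hessianMatrix (pLambda n) y).rank = dualVarietyDim (pLambda n) + 2 := by
  rw [dualVarietyDim_pLambda hn h3, show 2 * n - 2 + 2 = 2 * n by omega]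
  exact (rank_hessianMatrix_pLambda hn h3).2

end Literature.Computability.AlgebraicComplexity

end
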